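import Summits.CriticalPhenomena.CardyFormulaZ2.Theorems.CardyComplexConeEdgePrecompactUFRSRectMono
import Summits.CriticalPhenomena.CardyFormulaZ2.Theorems.CardyComplexConeEdgePrecompactUFRSStrandsArms

/-!
# Three strands of one completion ⇒ half-plane arms, VII: the rectangle dictionary
(line `qkz-strip-boundary-arm` of crux `CardyComplexCone.EdgePrecompact`, stmt-CriticalPhenomena-11387;
the bookkeeping that feeds `ℤ²`-admissible Dobrushin data of a rectangle into the abstract
combinatorial core `rect_threeArms` of the registered sub-goal `ufrs_rect_strandsHpArms_pure`)

For `ℤ²`-admissible data `E` of the open rectangle `(x₀, x₁) × (y₀, y₁)` (lattice box and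
discrete boundary from `…UFRSRectLatticeBox.lean`):

* `box_mem_iff_HTP`: the lattice box is `[a₀, a₁] × [b₀, b₁]` with `a₀ = ⌊x₀/δ⌋ + 1`,
  `a₁ = ⌈x₁/δ⌉ - 1`, `b₀ = ⌊y₀/δ⌋ + 1`, `b₁ = ⌈y₁/δ⌉ - 1`;
* `innerFace_bounds_HTP`: an inner face lies in the box with its upper and right neighbours;
* `arcs_on_sides_HTP`, `sides_in_arcs_HTP`: the two discrete arcs consist of box sites on the
  four sides, and every box site on a side lies on one of them;
* `bc_open_cases_HTP`, `bc_closed_cases_HTP`, `bc_closed_of_arcB_HTP`: the completed configuration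
  read in terms of `ω` (`mem_bcBondConfig_cases`, `not_mem_bcBondConfig_cases`);
* `ufrs_rect_nearSide` (registered anchor): a point of the rectangle at `infDist ≤ s` from its
  complement is within `s` of one of the four sides;
* `adapt_HTP`: the choice of the sector radius `R₁ ∈ {R/2, R/6}` making the exterior region of
  the box in the annulus connected (hypothesis of `annulus_exterior_preconnected`);
* `dist_meshPoint_eq_HTP`: rescaling of distances from mesh `δ` to mesh `1`.

References: S. Smirnov, C. R. Acad. Sci. Paris 333 (2001), §2; D. Chelkak, S. Smirnov, Invent.
Math. 189 (2012), §1.2 (discretisation conventions).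
-/

namespace Summit.CriticalPhenomena.CardyFormulaZ2.Cruxes.EdgePrecompact.QkzStripBoundaryArm

open MeasureTheory Filter Set Metric Complex
open scoped Topology BigOperators Pointwise
open Literature.Probability.LatticeModels Literature.Probability.Percolation
open Literature.Probability.RandomPlanarGeometry (DobrushinDomain)
open Summit.CriticalPhenomena.CardyFormulaZ2.Theses.CardyComplexCone

noncomputable section

/-! ## The lattice box in integer coordinates -/

section Box

variable {x₀ x₁ y₀ y₁ : ℝ} {E : DiscreteDobrushin}

/-- An open real interval condition on `δ k` in integer form. -/
theorem int_mem_Ioo_iff_HTP {δ lo hi : ℝ} (hδ : 0 < δ) (k : ℤ) :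
    (lo < δ * k ∧ δ * k < hi) ↔ (⌊lo / δ⌋ + 1 ≤ k ∧ k ≤ ⌈hi / δ⌉ - 1) := by
  have h1 : lo < δ * k ↔ ⌊lo / δ⌋ < k := by rw [Int.floor_lt, div_lt_iff₀ hδ, mul_comm]
  have h2 : δ * k < hi ↔ k < ⌈hi / δ⌉ := by rw [Int.lt_ceil, lt_div_iff₀ hδ, mul_comm]
  rw [h1, h2]
  omega

/-- **The lattice box of the rectangle in integer coordinates.** -/
theorem box_mem_iff_HTP (hE : E.IsZdAdmissible) (hEΩ : E.Ω = Set.Ioo x₀ x₁ ×ℂ Set.Ioo y₀ y₁) (v : Site 2) :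
    v ∈ meshVertices E.Ω E.δ ↔ ⌊x₀ / E.δ⌋ + 1 ≤ v 0 ∧ v 0 ≤ ⌈x₁ / E.δ⌉ - 1 ∧ ⌊y₀ / E.δ⌋ + 1 ≤ v 1 ∧ v 1 ≤ ⌈y₁ / E.δ⌉ - 1 := by
  rw [mem_meshVertices_rect' hEΩ, int_mem_Ioo_iff_HTP hE.delta_pos, int_mem_Ioo_iff_HTP hE.delta_pos]
  tauto

/-- **Inner faces lie in the box with their upper and right neighbours.** -/
theorem innerFace_bounds_HTP (hE : E.IsZdAdmissible) (hEΩ : E.Ω = Set.Ioo x₀ x₁ ×ℂ Set.Ioo y₀ y₁) {g : Site 2}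
    (hg : E.IsInnerFace g) :
    ⌊x₀ / E.δ⌋ + 1 ≤ g 0 ∧ g 0 + 1 ≤ ⌈x₁ / E.δ⌉ - 1 ∧ ⌊y₀ / E.δ⌋ + 1 ≤ g 1 ∧ g 1 + 1 ≤ ⌈y₁ / E.δ⌉ - 1 := by
  have hc : ∀ v : Site 2, (v = g ∨ v = g + Pi.single 0 1 ∨ v = g + Pi.single 1 1 ∨ v = g + Pi.single 0 1 + Pi.single 1 1) →
      IsCorner v g := by
    rintro v (rfl | rfl | rfl | rfl) <;> intro i <;> fin_cases i <;> simp
  have h1 : (discreteDomainGraph E.Ω E.δ).Adj g (g + Pi.single 0 1) :=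
    hg _ _ (hc _ (Or.inl rfl)) (hc _ (Or.inr (Or.inl rfl))) ((zdGraph_adj_iff _ _).2 ⟨0, Or.inl rfl⟩)
  have h2 : (discreteDomainGraph E.Ω E.δ).Adj (g + Pi.single 1 1) (g + Pi.single 0 1 + Pi.single 1 1) :=
    hg _ _ (hc _ (Or.inr (Or.inr (Or.inl rfl)))) (hc _ (Or.inr (Or.inr (Or.inr rfl))))
      ((zdGraph_adj_iff _ _).2 ⟨0, Or.inl (by abel)⟩)
  obtain ⟨-, hgV, -⟩ := (dom_adj_iff_rect hE hEΩ).1 h1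
  obtain ⟨-, -, hg'V⟩ := (dom_adj_iff_rect hE hEΩ).1 h2
  rw [box_mem_iff_HTP hE hEΩ] at hgV hg'V
  simp only [Pi.add_apply, Pi.single_eq_same, Pi.single_eq_of_ne (show (0 : Fin 2) ≠ 1 by decide),
    Pi.single_eq_of_ne (show (1 : Fin 2) ≠ 0 by decide)] at hg'V
  omega

/-- **The discrete arcs consist of box sites on the four sides.** -/
theorem arcs_on_sides_HTP (hE : E.IsZdAdmissible) (hEΩ : E.Ω = Set.Ioo x₀ x₁ ×ℂ Set.Ioo y₀ y₁) (x : Site 2)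
    (hx : x ∈ E.zdArcA ∨ x ∈ E.zdArcB) :
    x ∈ meshVertices E.Ω E.δ ∧ (x 0 = ⌊x₀ / E.δ⌋ + 1 ∨ x 0 = ⌈x₁ / E.δ⌉ - 1 ∨ x 1 = ⌊y₀ / E.δ⌋ + 1 ∨ x 1 = ⌈y₁ / E.δ⌉ - 1) := by
  have hxb : x ∈ E.zdBoundary := by
    rcases hx with hx | hx
    · exact E.zdArcA_subset_zdBoundary hx
    · exact E.zdArcB_subset_zdBoundary hx
  obtain ⟨hxV, y, hxy, hyV⟩ := exists_adj_not_mem_of_mem_zdBoundary hE hEΩ hxb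
  refine ⟨hxV, ?_⟩
  rw [box_mem_iff_HTP hE hEΩ] at hxV hyV
  rw [zdGraph_adj_iff, Fin.exists_fin_two] at hxy
  have hne01 : (0 : Fin 2) ≠ 1 := by decide
  have hne10 : (1 : Fin 2) ≠ 0 := by decide
  rcases hxy with (h | h) | (h | h)
  · rw [h] at hyV
    simp only [Pi.add_apply, Pi.single_eq_same, Pi.single_eq_of_ne hne10] at hyV; omega
  · have e0 : y 0 = x 0 - 1 := by have := congrFun h 0; simp at this; omega
    have e1 : y 1 = x 1 := by have := congrFun h 1; simp at this; omega
    rw [e0, e1] at hyV; omega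
  · rw [h] at hyV
    simp only [Pi.add_apply, Pi.single_eq_same, Pi.single_eq_of_ne hne01] at hyV; omega
  · have e0 : y 0 = x 0 := by have := congrFun h 0; simp at this; omega
    have e1 : y 1 = x 1 - 1 := by have := congrFun h 1; simp at this; omega
    rw [e0, e1] at hyV; omega

/-- **Box sites on the four sides lie on the discrete arcs.** -/
theorem sides_in_arcs_HTP (hE : E.IsZdAdmissible) (hEΩ : E.Ω = Set.Ioo x₀ x₁ ×ℂ Set.Ioo y₀ y₁) (x : Site 2)
    (hxV : x ∈ meshVertices E.Ω E.δ)
    (hs : x 0 = ⌊x₀ / E.δ⌋ + 1 ∨ x 0 = ⌈x₁ / E.δ⌉ - 1 ∨ x 1 = ⌊y₀ / E.δ⌋ + 1 ∨ x 1 = ⌈y₁ / E.δ⌉ - 1) :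
    x ∈ E.zdArcA ∨ x ∈ E.zdArcB := by
  have hne01 : (0 : Fin 2) ≠ 1 := by decide
  have hne10 : (1 : Fin 2) ≠ 0 := by decide
  have hxV' := (box_mem_iff_HTP hE hEΩ x).1 hxV
  have key : ∃ y, (zdGraph 2).Adj x y ∧ y ∉ meshVertices E.Ω E.δ := by
    rcases hs with h | h | h | h
    · refine ⟨Function.update x 0 (x 0 - 1), adj_update_sub_one x 0, fun hy => ?_⟩
      rw [box_mem_iff_HTP hE hEΩ] at hy; simp at hy; omega
    · refine ⟨Function.update x 0 (x 0 + 1), adj_update_add_one x 0, fun hy => ?_⟩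
      rw [box_mem_iff_HTP hE hEΩ] at hy; simp at hy; omega
    · refine ⟨Function.update x 1 (x 1 - 1), adj_update_sub_one x 1, fun hy => ?_⟩
      rw [box_mem_iff_HTP hE hEΩ] at hy; simp at hy; omega
    · refine ⟨Function.update x 1 (x 1 + 1), adj_update_add_one x 1, fun hy => ?_⟩
      rw [box_mem_iff_HTP hE hEΩ] at hy; simp at hy; omega
  obtain ⟨y, hxy, hyV⟩ := key
  exact hE.zdBoundary_subset (mem_zdBoundary_of_adj_not_mem hE hEΩ hxV hxy hyV)

end Box

/-! ## The completed configuration in terms of `ω` -/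

/-- A `β`-open edge is `ω`-open or wired, and does not touch the free arc. -/
theorem bc_open_cases_HTP {E : DiscreteDobrushin} (hE : E.IsZdAdmissible) (ω : BondConfig (Site 2)) :
    ∀ e ∈ E.bcBondConfig ω, (e ∈ ω ∨ ∀ x ∈ e, x ∈ E.zdArcA) ∧ ∀ x ∈ e, x ∉ E.zdArcB :=
  fun _ he => (mem_bcBondConfig_cases hE he).2

/-- The `β`-closed target edge of a corner with inner face is `ω`-closed or touches the free arc. -/
theorem bc_closed_cases_HTP {E : DiscreteDobrushin} (ω : BondConfig (Site 2)) :
    ∀ p : Site 2 × Fin 4, E.IsInnerFace (cFace p) → cTgt p ∉ E.bcBondConfig ω →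
      cTgt p ∉ ω ∨ ∃ x ∈ cTgt p, x ∈ E.zdArcB :=
  fun _ hp hc => (not_mem_bcBondConfig_cases (cTgt_mem_edgeSet_of_isInnerFace hp) hc).1

/-- Edges touching the free arc are `β`-closed. -/
theorem bc_closed_of_arcB_HTP {E : DiscreteDobrushin} (hE : E.IsZdAdmissible) (ω : BondConfig (Site 2)) :
    ∀ e : Sym2 (Site 2), (∃ x ∈ e, x ∈ E.zdArcB) → e ∉ E.bcBondConfig ω :=
  fun _ ⟨_, hxe, hxB⟩ => DiscreteDobrushin.not_mem_bcBondConfig_of_mem_zdArcB hE hxe hxB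

/-! ## The near side, the sector radius, rescaling -/

/-- **The near side** (registered anchor `ufrs_rect_nearSide` of stmt-CriticalPhenomena-11387):
a point of the open rectangle `(x₀, x₁) × (y₀, y₁)` whose distance to the complement is `≤ s`
is within `s` of one of the four side-lines. -/
theorem ufrs_rect_nearSide : ∀ (x₀ x₁ y₀ y₁ : ℝ) (z : ℂ) (s : ℝ), z ∈ Set.Ioo x₀ x₁ ×ℂ Set.Ioo y₀ y₁ → infDist z (Set.Ioo x₀ x₁ ×ℂ Set.Ioo y₀ y₁)ᶜ ≤ s → z.re - x₀ ≤ s ∨ x₁ - z.re ≤ s ∨ z.im - y₀ ≤ s ∨ y₁ - z.im ≤ s := by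
  intro x₀ x₁ y₀ y₁ z s hz hinf
  by_contra hcon
  simp only [not_or, not_le] at hcon
  obtain ⟨h1, h2, h3, h4⟩ := hcon
  set t : ℝ := min (min (z.re - x₀) (x₁ - z.re)) (min (z.im - y₀) (y₁ - z.im)) with ht
  have hst : s < t := by simp only [ht, lt_min_iff]; exact ⟨⟨h1, h2⟩, h3, h4⟩
  have hne : ((Set.Ioo x₀ x₁ ×ℂ Set.Ioo y₀ y₁)ᶜ).Nonempty := ⟨(x₀ : ℂ), by simp [Complex.mem_reProdIm]⟩
  obtain ⟨p, hp, hpz⟩ := (infDist_lt_iff hne).1 (lt_of_le_of_lt hinf hst)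
  apply hp
  rw [Complex.dist_eq] at hpz
  have hre := abs_le.1 ((abs_re_le_norm (z - p)).trans hpz.le)
  have him := abs_le.1 ((abs_im_le_norm (z - p)).trans hpz.le)
  rw [Complex.sub_re] at hre; rw [Complex.sub_im] at him
  have t1 : t ≤ z.re - x₀ := (min_le_left _ _).trans (min_le_left _ _)
  have t2 : t ≤ x₁ - z.re := (min_le_left _ _).trans (min_le_right _ _)
  have t3 : t ≤ z.im - y₀ := (min_le_right _ _).trans (min_le_left _ _)
  have t4 : t ≤ y₁ - z.im := (min_le_right _ _).trans (min_le_right _ _)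
  have hre' : |z.re - p.re| < t := (abs_re_le_norm (z - p)).trans_lt hpz
  have him' : |z.im - p.im| < t := (abs_im_le_norm (z - p)).trans_lt hpz
  have := abs_lt.1 hre'; have := abs_lt.1 him'
  rw [Complex.mem_reProdIm, Set.mem_Ioo, Set.mem_Ioo]
  exact ⟨⟨by linarith, by linarith⟩, by linarith, by linarith⟩

/-- Core of the choice of the sector radius: `p ≤ r` is the near distance, `p + q ≥ R`,
`u ≤ v` with `u + v ≥ R`. -/
theorem adapt_core_HTP (p q u v r R : ℝ) (hr : 1 ≤ r) (hR : 200 * r ≤ R) (hp : p ≤ r) (hpq : R ≤ p + q)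
    (huv : u ≤ v) (hRuv : R ≤ u + v) :
    ∃ R₁ : ℝ, (R₁ = R / 2 ∨ R₁ = R / 6) ∧
      (p < R₁ - 1 / 2 → p < (R₁ - 1 / 2) / 3) ∧ (q < R₁ - 1 / 2 → q < (R₁ - 1 / 2) / 3) ∧
      (u < R₁ - 1 / 2 → u < (R₁ - 1 / 2) / 3) ∧ (v < R₁ - 1 / 2 → v < (R₁ - 1 / 2) / 3) := by
  by_cases hmid : (R / 2 - 1 / 2) / 3 ≤ u ∧ u < R / 2 - 1 / 2
  · refine ⟨R / 6, Or.inr rfl, fun _ => by linarith, fun h => by linarith, fun h => ?_, fun h => ?_⟩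
    · linarith [hmid.1]
    · linarith [hmid.1]
  · rw [not_and_or, not_le, not_lt] at hmid
    refine ⟨R / 2, Or.inl rfl, fun _ => by linarith, fun h => by linarith, fun h => ?_, fun h => ?_⟩
    · rcases hmid with h' | h'
      · exact h'
      · linarith
    · rcases hmid with h' | h'
      · linarith
      · linarith

/-- **Choice of the sector radius.** Given the four distances from `z` to the side-lines of the
shrunk box, one of them `≤ r`, opposite ones summing to `≥ R ≥ 200 r`: some `R₁ ∈ {R/2, R/6}`
satisfies the adaptivity hypothesis of `annulus_exterior_preconnected`. -/
theorem adapt_HTP (dL dR dB dT r R : ℝ) (hr : 1 ≤ r) (hR : 200 * r ≤ R)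
    (hnear : dL ≤ r ∨ dR ≤ r ∨ dB ≤ r ∨ dT ≤ r) (hLR : R ≤ dL + dR) (hBT : R ≤ dB + dT) :
    ∃ R₁ : ℝ, (R₁ = R / 2 ∨ R₁ = R / 6) ∧
      (dL < R₁ - 1 / 2 → dL < (R₁ - 1 / 2) / 3) ∧ (dR < R₁ - 1 / 2 → dR < (R₁ - 1 / 2) / 3) ∧
      (dB < R₁ - 1 / 2 → dB < (R₁ - 1 / 2) / 3) ∧ (dT < R₁ - 1 / 2 → dT < (R₁ - 1 / 2) / 3) := by
  rcases hnear with h | h | h | h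
  · rcases le_total dB dT with h' | h'
    · obtain ⟨R₁, h1, h2, h3, h4, h5⟩ := adapt_core_HTP dL dR dB dT r R hr hR h hLR h' hBT
      exact ⟨R₁, h1, h2, h3, h4, h5⟩
    · obtain ⟨R₁, h1, h2, h3, h4, h5⟩ := adapt_core_HTP dL dR dT dB r R hr hR h hLR h' (by linarith)
      exact ⟨R₁, h1, h2, h3, h5, h4⟩
  · rcases le_total dB dT with h' | h'
    · obtain ⟨R₁, h1, h2, h3, h4, h5⟩ := adapt_core_HTP dR dL dB dT r R hr hR h (by linarith) h' hBT
      exact ⟨R₁, h1, h3, h2, h4, h5⟩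
    · obtain ⟨R₁, h1, h2, h3, h4, h5⟩ := adapt_core_HTP dR dL dT dB r R hr hR h (by linarith) h' (by linarith)
      exact ⟨R₁, h1, h3, h2, h5, h4⟩
  · rcases le_total dL dR with h' | h'
    · obtain ⟨R₁, h1, h2, h3, h4, h5⟩ := adapt_core_HTP dB dT dL dR r R hr hR h hBT h' hLR
      exact ⟨R₁, h1, h4, h5, h2, h3⟩
    · obtain ⟨R₁, h1, h2, h3, h4, h5⟩ := adapt_core_HTP dB dT dR dL r R hr hR h hBT h' (by linarith)
      exact ⟨R₁, h1, h5, h4, h2, h3⟩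
  · rcases le_total dL dR with h' | h'
    · obtain ⟨R₁, h1, h2, h3, h4, h5⟩ := adapt_core_HTP dT dB dL dR r R hr hR h (by linarith) h' hLR
      exact ⟨R₁, h1, h4, h5, h3, h2⟩
    · obtain ⟨R₁, h1, h2, h3, h4, h5⟩ := adapt_core_HTP dT dB dR dL r R hr hR h (by linarith) h' (by linarith)
      exact ⟨R₁, h1, h5, h4, h3, h2⟩

/-- **Rescaling of distances**: `dist (δ v) z = δ · dist (v, z/δ)`. -/
theorem dist_meshPoint_eq_HTP {δ : ℝ} (hδ : 0 < δ) (v : Site 2) (z : ℂ) :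
    dist (meshPoint δ v) z = δ * dist (Site.toComplex v) ((δ : ℂ)⁻¹ * z) := by
  have hδ0 : (δ : ℂ) ≠ 0 := ofReal_ne_zero.2 hδ.ne'
  rw [dist_eq_norm, dist_eq_norm, show meshPoint δ v - z = (δ : ℂ) * (Site.toComplex v - (δ : ℂ)⁻¹ * z) by
    rw [mul_sub, mul_inv_cancel_left₀ hδ0]; rfl, norm_mul, Complex.norm_of_nonneg hδ.le]

/-- Coordinates of the rescaled centre `z/δ`. -/
theorem rescale_re_im_HTP (δ : ℝ) (z : ℂ) :
    ((δ : ℂ)⁻¹ * z).re = z.re / δ ∧ ((δ : ℂ)⁻¹ * z).im = z.im / δ := by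
  rw [← ofReal_inv, re_ofReal_mul, im_ofReal_mul, div_eq_inv_mul, div_eq_inv_mul]
  exact ⟨rfl, rfl⟩

end

end Summit.CriticalPhenomena.CardyFormulaZ2.Cruxes.EdgePrecompact.QkzStripBoundaryArm
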